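import Mathlib
import Literature.NumberTheory.Sieve.RoughOmegaCells
import Summits.Parity.GeneralizedHardyLittlewood.Theorems.ParityLeakOneFifthPlainSplitCalibReductionPointwise
import HarnessLib

/-!
# Route ParityLeakOneFifth, crux `ParityLeakSieve` (stmt-Parity-18381), skeleton `birth`:
# the census of the truncated Möbius sum on rough integers (pointwise lemmas)

With `G(m) = Σ_{d ∣ m, d ≤ D} μ(d)` on a `y`-rough `m` (`1 ≤ D < y³`, `D² < m`), this file proves the
two pointwise inequalities consumed by the line `birth`:

* (stub S1, host side) `G(m) ≤ 1[m prime] + 1[D < P⁻(m), Ω(m) = 2] + 32·1[Ω(m) = 5] + 32·1[m not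
  squarefree]` (`truncMoebius_le`), under the window conditions "`Ω = 3 ⇒` at least two prime
  factors `≤ D`", "`Ω = 4 ⇒` every prime factor `≤ D`";
* (stub S2, model side, the ZERO PARITY DEFECT at `ν = 1/5`)
  `(1 + λ(m))·G(m) ≥ −2·#{d ∣ m : Ω(d) = 2, D < d, d² < m} − 64·1[m not squarefree]`
  (`onePlusLiouville_truncMoebius_ge`): odd types vanish, `Ω = 2` has `G ≥ 0`, and for `Ω = 4`
  the six semiprime divisors split into three complementary pairs, so that
  `G = s₂ − 3 ≥ −#{semiprime d ∣ m : D < d, d² < m}` (`three_le_card_small_semiprime_divisors`).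
-/

namespace Summit.Parity.GeneralizedHardyLittlewood.Theorems.ParityLeakOneFifth

open Finset
open scoped ArithmeticFunction.Omega ArithmeticFunction.Moebius
open Literature.NumberTheory.Sieve

/-! ### Semiprime divisors of a squarefree integer with four prime factors -/

/-- A squarefree `m` with `Ω(m) = 4` has at least six semiprime divisors (`{p, q} ↦ pq`). -/
theorem six_le_card_semiprime_divisors {m : ℕ} (hm : Squarefree m) (hΩ : Ω m = 4) :
    6 ≤ #((Nat.divisors m).filter (fun d : ℕ => Ω d = 2)) := by
  have hm0 : m ≠ 0 := hm.ne_zero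
  have hcard : #(m.primeFactors.powersetCard 2) = 6 := by
    rw [Finset.card_powersetCard, card_primeFactors_eq_cardFactors hm, hΩ]; rfl
  rw [← hcard]
  refine Finset.card_le_card_of_injOn (fun S => ∏ p ∈ S, p) ?_ ?_
  · intro S hS
    rw [Finset.mem_coe, Finset.mem_powersetCard] at hS
    obtain ⟨hsub, hc⟩ := hS
    obtain ⟨p, q, hpq, rfl⟩ := Finset.card_eq_two.1 hc
    have hp : p.Prime := Nat.prime_of_mem_primeFactors (hsub (by simp))
    have hq : q.Prime := Nat.prime_of_mem_primeFactors (hsub (by simp))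
    simp only [Finset.mem_coe, Finset.mem_filter, Finset.prod_pair hpq]
    refine ⟨Nat.mem_divisors.2 ⟨?_, hm0⟩, ?_⟩
    · have hcop : Nat.Coprime p q := (Nat.coprime_primes hp hq).2 hpq
      exact hcop.mul_dvd_of_dvd_of_dvd (Nat.dvd_of_mem_primeFactors (hsub (by simp)))
        (Nat.dvd_of_mem_primeFactors (hsub (by simp)))
    · rw [ArithmeticFunction.cardFactors_mul hp.ne_zero hq.ne_zero,
        ArithmeticFunction.cardFactors_apply_prime hp, ArithmeticFunction.cardFactors_apply_prime hq]
  · intro S hS T hT h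
    rw [Finset.mem_coe, Finset.mem_powersetCard] at hS hT
    have hSp : ∀ p ∈ S, p.Prime := fun p hp => Nat.prime_of_mem_primeFactors (hS.1 hp)
    have hTp : ∀ p ∈ T, p.Prime := fun p hp => Nat.prime_of_mem_primeFactors (hT.1 hp)
    simp only at h
    have e1 := Nat.primeFactors_prod hSp
    have e2 := Nat.primeFactors_prod hTp
    rw [← e1, ← e2, h]

/-- A squarefree `m` with `Ω(m) = 4` has at least three semiprime divisors `d` with `d² < m` (of each
complementary pair `{d, m/d}` exactly one; the map `d ↦ m/d` sends the others injectively to them). -/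
theorem three_le_card_small_semiprime_divisors {m : ℕ} (hm : Squarefree m) (hΩ : Ω m = 4) :
    3 ≤ #((Nat.divisors m).filter (fun d : ℕ => Ω d = 2 ∧ d * d < m)) := by
  have hm0 : m ≠ 0 := hm.ne_zero
  set S := (Nat.divisors m).filter (fun d : ℕ => Ω d = 2) with hS
  set T := (Nat.divisors m).filter (fun d : ℕ => Ω d = 2 ∧ d * d < m) with hT
  set B := (Nat.divisors m).filter (fun d : ℕ => Ω d = 2 ∧ m < d * d) with hB
  have h6 : 6 ≤ #S := six_le_card_semiprime_divisors hm hΩ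
  -- no semiprime divisor has `d² = m`
  have hne : ∀ d ∈ S, d * d ≠ m := by
    intro d _ h
    have hsq : Squarefree (d * d) := by rw [h]; exact hm
    have hd1 : d = 1 := (Nat.coprime_self d).1 (Nat.squarefree_mul_iff.1 hsq).1
    subst hd1
    rw [mul_one] at h
    subst h
    simp at hΩ
  have hsplit : #T + #B = #S := by
    rw [hT, hB, hS, ← Finset.filter_filter, ← Finset.filter_filter]
    have h := Finset.card_filter_add_card_filter_not (s := S) (fun d : ℕ => d * d < m)
    have e : S.filter (fun d : ℕ => ¬ d * d < m) = S.filter (fun d : ℕ => m < d * d) := by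
      refine Finset.filter_congr fun d hd => ?_
      constructor
      · intro h1; exact lt_of_le_of_ne (not_lt.1 h1) (Ne.symm (hne d hd))
      · intro h1; exact not_lt.2 h1.le
    rw [e] at h
    exact h
  -- `d ↦ m / d` maps `B` injectively into `T`
  have hinj : #B ≤ #T := by
    refine Finset.card_le_card_of_injOn (fun d => m / d) ?_ ?_
    · intro d hd
      rw [Finset.mem_coe, hB, Finset.mem_filter] at hd
      obtain ⟨hdiv, hΩd, hbig⟩ := hd
      have hd0 : d ≠ 0 := (Nat.pos_of_mem_divisors hdiv).ne'
      obtain ⟨k, hk⟩ := Nat.dvd_of_mem_divisors hdiv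
      have hk0 : k ≠ 0 := by rintro rfl; simp at hk; exact hm0 hk
      have hmk : m / d = k := by rw [hk, Nat.mul_div_cancel_left k (Nat.pos_of_ne_zero hd0)]
      simp only [Finset.mem_coe, hT, Finset.mem_filter, hmk]
      refine ⟨Nat.mem_divisors.2 ⟨⟨d, by rw [hk, mul_comm]⟩, hm0⟩, ?_, ?_⟩
      · have := ArithmeticFunction.cardFactors_mul hd0 hk0
        rw [← hk, hΩ, hΩd] at this; omega
      · -- `m < d²` and `m = dk` give `k < d`, hence `k² < dk = m`
        have hkd : k < d := by
          by_contra h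
          push Not at h
          have : d * d ≤ d * k := Nat.mul_le_mul_left d h
          rw [← hk] at this
          omega
        calc k * k < k * d := Nat.mul_lt_mul_of_pos_left hkd (Nat.pos_of_ne_zero hk0)
          _ = m := by rw [hk, mul_comm]
    · intro d₁ hd₁ d₂ hd₂ h
      rw [Finset.mem_coe, hB, Finset.mem_filter] at hd₁ hd₂
      have h1 := Nat.dvd_of_mem_divisors hd₁.1
      have h2 := Nat.dvd_of_mem_divisors hd₂.1
      simp only at h
      have := Nat.div_div_self h1 hm0
      rw [h, Nat.div_div_self h2 hm0] at this
      exact this.symm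
  omega

/-- For squarefree `m` with `Ω(m) = 4` and `D ≥ 0`:
`3 ≤ #{d ∣ m : Ω d = 2, d ≤ D} + #{d ∣ m : Ω d = 2, D < d, d² < m}`. -/
theorem three_le_card_add_card {m : ℕ} (hm : Squarefree m) (hΩ : Ω m = 4) (D : ℝ) :
    3 ≤ #((Nat.divisors m).filter (fun d : ℕ => Ω d = 2 ∧ (d : ℝ) ≤ D)) +
      #((Nat.divisors m).filter (fun d : ℕ => Ω d = 2 ∧ D < (d : ℝ) ∧ d * d < m)) := by
  refine (three_le_card_small_semiprime_divisors hm hΩ).trans ?_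
  rw [← Finset.card_union_of_disjoint]
  · refine Finset.card_le_card fun d hd => ?_
    rw [Finset.mem_filter] at hd
    rw [Finset.mem_union, Finset.mem_filter, Finset.mem_filter]
    by_cases h : (d : ℝ) ≤ D
    · exact Or.inl ⟨hd.1, hd.2.1, h⟩
    · exact Or.inr ⟨hd.1, hd.2.1, not_le.1 h, hd.2.2⟩
  · rw [Finset.disjoint_filter]
    intro d _ h1 h2
    exact absurd h1.2 (not_le.2 h2.2.1)

/-! ### The zero parity defect: `(1 + λ) G` on rough integers -/

/-- **Pointwise inequality for the model side (zero parity defect at `ν = 1/5`).** For a `y`-rough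
`m ≥ 2` with `Ω m ≤ 5`, `1 ≤ D < y³`, `D² < m` and "`Ω m = 4 ⇒` all prime factors `≤ D`":
`(1 + λ(m))·G(m) ≥ −2·#{d ∣ m : Ω d = 2, D < d, d² < m} − 64·1[m not squarefree]`. -/
theorem onePlusLiouville_truncMoebius_ge {m : ℕ} {y D : ℝ} (hm2 : 2 ≤ m) (hy : 1 ≤ y) (hD1 : 1 ≤ D)
    (hDy : D < y ^ 3) (hDm : D ^ 2 < m) (hr : ∀ p ∈ m.primeFactors, y ≤ (p : ℝ)) (hΩ5 : Ω m ≤ 5)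
    (h4 : Ω m = 4 → ∀ p ∈ m.primeFactors, (p : ℝ) ≤ D) :
    -2 * (#((Nat.divisors m).filter (fun d : ℕ => Ω d = 2 ∧ D < (d : ℝ) ∧ d * d < m)) : ℝ) -
        64 * (if ¬ Squarefree m then 1 else 0) ≤
      (1 + (ArithmeticFunction.liouville m : ℝ)) *
        ∑ d ∈ (Nat.divisors m).filter (fun d : ℕ => (d : ℝ) ≤ D), (μ d : ℝ) := by
  have hm0 : m ≠ 0 := by omega
  have hDm' : D < m := by nlinarith
  have hlam : (ArithmeticFunction.liouville m : ℝ) = (-1) ^ Ω m := by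
    rw [ArithmeticFunction.liouville_apply hm0]; push_cast; ring
  have hK0 : (0 : ℝ) ≤ #((Nat.divisors m).filter (fun d : ℕ => Ω d = 2 ∧ D < (d : ℝ) ∧ d * d < m)) :=
    Nat.cast_nonneg _
  by_cases hsq : Squarefree m
  · rw [if_neg (not_not.2 hsq), mul_zero, sub_zero, truncMoebius_eq hy hDy hD1 hsq hr, hlam]
    set s₁ : ℝ := (#((Nat.divisors m).filter (fun d : ℕ => d.Prime ∧ (d : ℝ) ≤ D)) : ℝ) with hs₁
    set s₂ : ℝ := (#((Nat.divisors m).filter (fun d : ℕ => Ω d = 2 ∧ (d : ℝ) ≤ D)) : ℝ) with hs₂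
    have hs₂0 : 0 ≤ s₂ := by rw [hs₂]; exact Nat.cast_nonneg _
    have hΩ1 : 1 ≤ Ω m := by
      rw [← card_primeFactors_eq_cardFactors hsq, Finset.one_le_card]
      exact ⟨m.minFac, Nat.mem_primeFactors.2 ⟨Nat.minFac_prime (by omega), Nat.minFac_dvd m, hm0⟩⟩
    interval_cases hΩm : Ω m
    · norm_num
    · -- `Ω = 2`: `s₂ = 0`, `s₁ ≤ 1`
      have e2 : s₂ = 0 := by
        rw [hs₂]; exact_mod_cast card_filter_two_divisors_eq_zero hm0 hΩm hDm'
      have e1 : s₁ ≤ 1 := by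
        rw [hs₁, card_filter_prime_divisors_of_two hsq hΩm (by linarith) hDm]
        split_ifs <;> norm_num
      rw [e2]; norm_num; nlinarith
    · norm_num
    · -- `Ω = 4`: `s₁ = 4`, `3 ≤ s₂ + K`
      have e1 : s₁ = 4 := by
        rw [hs₁]; exact_mod_cast (card_filter_prime_divisors_eq_cardFactors hsq (h4 rfl)).trans hΩm
      have e3 : (3 : ℝ) ≤ s₂ +
          #((Nat.divisors m).filter (fun d : ℕ => Ω d = 2 ∧ D < (d : ℝ) ∧ d * d < m)) := by
        rw [hs₂]; exact_mod_cast three_le_card_add_card hsq hΩm D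
      rw [e1]; norm_num; linarith
    · norm_num
  · -- not squarefree: `|(1+λ)G| ≤ 2·32`
    rw [if_pos hsq]
    have hG := abs_truncMoebius_le hm0 D
    have h32 : (2 : ℝ) ^ Ω m ≤ 32 := by
      calc (2 : ℝ) ^ Ω m ≤ 2 ^ 5 := pow_le_pow_right₀ (by norm_num) hΩ5
        _ = 32 := by norm_num
    have hlam1 : |1 + (ArithmeticFunction.liouville m : ℝ)| ≤ 2 := by
      rw [hlam]
      rcases neg_one_pow_eq_or ℝ (Ω m) with h | h <;> rw [h] <;> norm_num
    have hprod : |(1 + (ArithmeticFunction.liouville m : ℝ)) *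
        ∑ d ∈ (Nat.divisors m).filter (fun d : ℕ => (d : ℝ) ≤ D), (μ d : ℝ)| ≤ 64 := by
      rw [abs_mul]
      calc _ ≤ 2 * 32 := mul_le_mul hlam1 (hG.trans h32) (abs_nonneg _) (by norm_num)
        _ = 64 := by norm_num
    have h1 := (abs_le.1 hprod).1
    linarith

/-! ### The lower-bound sieve: `G` against `1_prime` -/

/-- Squarefree `m`, `Ω m = 3`, `m > D²`, `D ≥ 0`: the semiprime divisors `≤ D` are at most as many as
the prime divisors `> D` (`d ↦ m/d`). -/
theorem card_filter_two_divisors_le_of_three {m : ℕ} (hm : Squarefree m) (hΩ : Ω m = 3) {D : ℝ}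
    (hD0 : 0 ≤ D) (hD : D ^ 2 < m) :
    #((Nat.divisors m).filter (fun d : ℕ => Ω d = 2 ∧ (d : ℝ) ≤ D)) ≤
      #((Nat.divisors m).filter (fun d : ℕ => d.Prime ∧ D < (d : ℝ))) := by
  have hm0 : m ≠ 0 := hm.ne_zero
  refine Finset.card_le_card_of_injOn (fun d => m / d) ?_ ?_
  · intro d hd
    rw [Finset.mem_coe, Finset.mem_filter] at hd
    obtain ⟨hdiv, hΩd, hdD⟩ := hd
    have hd0 : d ≠ 0 := (Nat.pos_of_mem_divisors hdiv).ne'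
    obtain ⟨k, hk⟩ := Nat.dvd_of_mem_divisors hdiv
    have hk0 : k ≠ 0 := by rintro rfl; simp at hk; exact hm0 hk
    have hmk : m / d = k := by rw [hk, Nat.mul_div_cancel_left k (Nat.pos_of_ne_zero hd0)]
    simp only [Finset.mem_coe, Finset.mem_filter, hmk]
    have hΩk : Ω k = 1 := by
      have := ArithmeticFunction.cardFactors_mul hd0 hk0
      rw [← hk, hΩ, hΩd] at this; omega
    refine ⟨Nat.mem_divisors.2 ⟨⟨d, by rw [hk, mul_comm]⟩, hm0⟩,
      ArithmeticFunction.cardFactors_eq_one_iff_prime.1 hΩk, ?_⟩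
    have hcast : (d : ℝ) * k = m := by rw [hk]; push_cast; ring
    by_contra hle
    rw [not_lt] at hle
    have hd0' : (0 : ℝ) ≤ d := Nat.cast_nonneg d
    have hk0' : (0 : ℝ) ≤ k := Nat.cast_nonneg k
    nlinarith [mul_le_mul hdD hle hk0' hD0]
  · intro d₁ hd₁ d₂ hd₂ h
    rw [Finset.mem_coe, Finset.mem_filter] at hd₁ hd₂
    have h1 := Nat.dvd_of_mem_divisors hd₁.1
    have h2 := Nat.dvd_of_mem_divisors hd₂.1
    simp only at h
    have := Nat.div_div_self h1 hm0
    rw [h, Nat.div_div_self h2 hm0] at this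
    exact this.symm

/-- For squarefree `m`: `s₁ + #{p ∣ m prime : D < p} = Ω m`. -/
theorem card_small_add_card_large_primes {m : ℕ} (hm : Squarefree m) (D : ℝ) :
    #((Nat.divisors m).filter (fun d : ℕ => d.Prime ∧ (d : ℝ) ≤ D)) +
      #((Nat.divisors m).filter (fun d : ℕ => d.Prime ∧ D < (d : ℝ))) = Ω m := by
  rw [← card_primeFactors_eq_cardFactors hm, card_filter_prime_divisors_eq m D]
  have e : #((Nat.divisors m).filter (fun d : ℕ => d.Prime ∧ D < (d : ℝ))) =
      #(m.primeFactors.filter (fun p : ℕ => D < (p : ℝ))) := by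
    congr 1; ext d
    simp only [Finset.mem_filter, Nat.mem_divisors, Nat.mem_primeFactors]
    tauto
  rw [e]
  have h := Finset.card_filter_add_card_filter_not (s := m.primeFactors) (fun p : ℕ => (p : ℝ) ≤ D)
  simp only [not_le] at h
  exact h

/-- A `y`-rough squarefree `m` with `Ω m = 3` and `m ≤ D² y` (`y > 0`, `D ≥ 0`) has at most one
prime factor `> D`, i.e. at least two prime factors `≤ D`. -/
theorem card_large_primes_le_one_of_three {m : ℕ} {y D : ℝ} (hm : Squarefree m) (hΩ : Ω m = 3)
    (hy : 0 < y) (hD0 : 0 ≤ D) (hr : ∀ p ∈ m.primeFactors, y ≤ (p : ℝ))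
    (hmD : (m : ℝ) ≤ D ^ 2 * y) :
    #((Nat.divisors m).filter (fun d : ℕ => d.Prime ∧ D < (d : ℝ))) ≤ 1 := by
  have hm0 : m ≠ 0 := hm.ne_zero
  by_contra h
  push Not at h
  obtain ⟨q, hq, r, hr', hqr⟩ := Finset.one_lt_card.1 h
  rw [Finset.mem_filter] at hq hr'
  obtain ⟨hqd, hqp, hqD⟩ := hq
  obtain ⟨hrd, hrp, hrD⟩ := hr'
  -- `q r ∣ m`, cofactor `k ≥ y`
  have hcop : Nat.Coprime q r := (Nat.coprime_primes hqp hrp).2 hqr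
  obtain ⟨k, hk⟩ := hcop.mul_dvd_of_dvd_of_dvd (Nat.dvd_of_mem_divisors hqd) (Nat.dvd_of_mem_divisors hrd)
  have hk0 : k ≠ 0 := by rintro rfl; simp at hk; exact hm0 hk
  have hΩk : Ω k = 1 := by
    have := ArithmeticFunction.cardFactors_mul (mul_ne_zero hqp.ne_zero hrp.ne_zero) hk0
    rw [← hk, hΩ, ArithmeticFunction.cardFactors_mul hqp.ne_zero hrp.ne_zero,
      ArithmeticFunction.cardFactors_apply_prime hqp, ArithmeticFunction.cardFactors_apply_prime hrp] at this
    omega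
  have hkp : k.Prime := ArithmeticFunction.cardFactors_eq_one_iff_prime.1 hΩk
  have hky : y ≤ (k : ℝ) := hr k (Nat.mem_primeFactors.2 ⟨hkp, ⟨q * r, by rw [hk]; ring⟩, hm0⟩)
  have hcast : (m : ℝ) = q * r * k := by rw [hk]; push_cast; ring
  have hq0 : (0 : ℝ) ≤ q := Nat.cast_nonneg q
  have hr0 : (0 : ℝ) ≤ r := Nat.cast_nonneg r
  have hqr' : D ^ 2 < (q : ℝ) * r := by nlinarith [mul_lt_mul'' hqD hrD hD0 hD0]
  have : D ^ 2 * y < (q : ℝ) * r * k := by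
    calc D ^ 2 * y ≤ D ^ 2 * k := mul_le_mul_of_nonneg_left hky (by positivity)
      _ < (q : ℝ) * r * k := mul_lt_mul_of_pos_right hqr' (by linarith)
  linarith

/-- **Pointwise inequality for the host side.** For a `y`-rough `m ≥ 2` with `Ω m ≤ 5`, `1 ≤ D < y³`,
`D² < m`, and the size conditions "`Ω m = 3 ⇒ m ≤ D² y`", "`Ω m = 4 ⇒` all prime factors `≤ D`":
`G(m) ≤ 1[m prime] + 1[D < minFac m ∧ Ω m = 2] + 32·1[Ω m = 5] + 32·1[¬ squarefree m]`. -/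
theorem truncMoebius_le {m : ℕ} {y D : ℝ} (hm2 : 2 ≤ m) (hy : 1 ≤ y) (hD1 : 1 ≤ D)
    (hDy : D < y ^ 3) (hDm : D ^ 2 < m) (hr : ∀ p ∈ m.primeFactors, y ≤ (p : ℝ)) (hΩ5 : Ω m ≤ 5)
    (h3 : Ω m = 3 → (m : ℝ) ≤ D ^ 2 * y)
    (h4 : Ω m = 4 → ∀ p ∈ m.primeFactors, (p : ℝ) ≤ D) :
    ∑ d ∈ (Nat.divisors m).filter (fun d : ℕ => (d : ℝ) ≤ D), (μ d : ℝ) ≤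
      (if m.Prime then (1 : ℝ) else 0) + (if D < (m.minFac : ℝ) ∧ Ω m = 2 then 1 else 0) +
        32 * (if Ω m = 5 then 1 else 0) + 32 * (if ¬ Squarefree m then 1 else 0) := by
  have hm0 : m ≠ 0 := by omega
  have hDm' : D < m := by nlinarith
  have hA : (0 : ℝ) ≤ (if m.Prime then (1 : ℝ) else 0) := by positivity
  have hB : (0 : ℝ) ≤ (if D < (m.minFac : ℝ) ∧ Ω m = 2 then (1 : ℝ) else 0) := by positivity
  have hC : (0 : ℝ) ≤ (if Ω m = 5 then (1 : ℝ) else 0) := by positivity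
  by_cases hsq : Squarefree m
  · rw [if_neg (not_not.2 hsq), mul_zero, add_zero, truncMoebius_eq hy hDy hD1 hsq hr]
    set s₁ : ℝ := (#((Nat.divisors m).filter (fun d : ℕ => d.Prime ∧ (d : ℝ) ≤ D)) : ℝ) with hs₁
    set s₂ : ℝ := (#((Nat.divisors m).filter (fun d : ℕ => Ω d = 2 ∧ (d : ℝ) ≤ D)) : ℝ) with hs₂
    have hs₁le : s₁ ≤ Ω m := by rw [hs₁]; exact_mod_cast card_filter_prime_divisors_le hsq D
    have hs₁0 : 0 ≤ s₁ := by rw [hs₁]; exact Nat.cast_nonneg _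
    have hs₂0 : 0 ≤ s₂ := by rw [hs₂]; exact Nat.cast_nonneg _
    have hΩ1 : 1 ≤ Ω m := by
      rw [← card_primeFactors_eq_cardFactors hsq, Finset.one_le_card]
      exact ⟨m.minFac, Nat.mem_primeFactors.2 ⟨Nat.minFac_prime (by omega), Nat.minFac_dvd m, hm0⟩⟩
    interval_cases hΩm : Ω m
    · -- `Ω = 1`: `m` prime, `s₁ = s₂ = 0`
      have hp : m.Prime := ArithmeticFunction.cardFactors_eq_one_iff_prime.1 hΩm
      have e1 : s₁ = 0 := by
        rw [hs₁, card_filter_prime_divisors_eq m, Nat.Prime.primeFactors hp]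
        norm_cast
        rw [Finset.card_eq_zero, Finset.filter_eq_empty_iff]
        intro r hr' hle; rw [Finset.mem_singleton] at hr'; subst hr'; linarith
      have e2 : s₂ = 0 := by
        rw [hs₂]; norm_cast
        rw [Finset.card_eq_zero, Finset.filter_eq_empty_iff]
        rintro d hd ⟨hΩd, -⟩
        have := cardFactors_le_of_dvd hm0 (Nat.dvd_of_mem_divisors hd); omega
      simp only [if_pos hp, e1, e2]
      norm_num
    · -- `Ω = 2`
      have hnp : ¬ m.Prime := fun h => by
        have := ArithmeticFunction.cardFactors_apply_prime h; omega
      have e2 : s₂ = 0 := by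
        rw [hs₂]; exact_mod_cast card_filter_two_divisors_eq_zero hm0 hΩm hDm'
      have e1 : s₁ = if (m.minFac : ℝ) ≤ D then 1 else 0 := by
        rw [hs₁]; exact_mod_cast card_filter_prime_divisors_of_two hsq hΩm (by linarith) hDm
      rw [if_neg hnp, e2, e1]
      by_cases hmf : (m.minFac : ℝ) ≤ D
      · rw [if_pos hmf, if_neg (fun h => not_lt.2 hmf h.1)]; norm_num
      · rw [if_neg hmf, if_pos ⟨not_le.1 hmf, rfl⟩]; norm_num
    · -- `Ω = 3`: `s₂ ≤ 3 − s₁`, `s₁ ≥ 2`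
      have hnp : ¬ m.Prime := fun h => by
        have := ArithmeticFunction.cardFactors_apply_prime h; omega
      have hsum := card_small_add_card_large_primes hsq D
      rw [hΩm] at hsum
      have hlarge := card_large_primes_le_one_of_three hsq hΩm (by linarith) (by linarith) hr (h3 rfl)
      have hs2 := card_filter_two_divisors_le_of_three hsq hΩm (by linarith) hDm
      have e1 : (2 : ℝ) ≤ s₁ := by
        rw [hs₁]
        have : 2 ≤ #((Nat.divisors m).filter (fun d : ℕ => d.Prime ∧ (d : ℝ) ≤ D)) := by omega
        exact_mod_cast this
      have e2 : s₂ ≤ 1 := by rw [hs₂]; exact_mod_cast hs2.trans hlarge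
      rw [if_neg hnp]
      norm_num; linarith
    · -- `Ω = 4`: `s₁ = 4`, `s₂ ≤ 3`
      have hnp : ¬ m.Prime := fun h => by
        have := ArithmeticFunction.cardFactors_apply_prime h; omega
      have e1 : s₁ = 4 := by
        rw [hs₁]; exact_mod_cast (card_filter_prime_divisors_eq_cardFactors hsq (h4 rfl)).trans hΩm
      have e2 : s₂ ≤ 3 := by
        rw [hs₂]; exact_mod_cast card_filter_two_divisors_le_three hsq hΩm (by linarith) hDm
      rw [if_neg hnp, e1]
      norm_num; linarith
    · -- `Ω = 5`: `|G| ≤ 32`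
      have hG := abs_truncMoebius_le hm0 D
      rw [truncMoebius_eq hy hDy hD1 hsq hr, hΩm] at hG
      have h1 := (abs_le.1 hG).2
      norm_num at h1 ⊢; linarith
  · -- not squarefree: `|G| ≤ 2^Ω ≤ 32`
    have hnp : ¬ m.Prime := fun h => hsq h.squarefree
    rw [if_pos hsq]
    have hG := abs_truncMoebius_le hm0 D
    have h32 : (2 : ℝ) ^ Ω m ≤ 32 := by
      calc (2 : ℝ) ^ Ω m ≤ 2 ^ 5 := pow_le_pow_right₀ (by norm_num) hΩ5
        _ = 32 := by norm_num
    have h1 := (abs_le.1 (hG.trans h32)).2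
    linarith

end Summit.Parity.GeneralizedHardyLittlewood.Theorems.ParityLeakOneFifth
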